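import Summits.MatrixMultiplication.MatrixMultiplication.Theses.FidelityWitnesses
import Literature.Computability.AlgebraicComplexity.AlderStrassen
import Summits.MatrixMultiplication.MatrixMultiplication.Theorems.FidelityWitnessesSevenEighthsLawStubSliceElimination
import Summits.MatrixMultiplication.MatrixMultiplication.Theorems.FidelityWitnessesSevenEighthsLawStubProductFrame

/-!
# `FidelityWitnesses.SevenEighthsLaw` ⟺ a capture bound on product-spanned 6-planes (exact reduction)

Support file for crux item `stmt-MatrixMultiplication-4959`
(`Summit.MatrixMultiplication.MatrixMultiplication.Theses.FidelityWitnesses.SevenEighthsLaw`, `M(2,6) = 7`: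
`|⟨S, ⟨2,2,2⟩⟩|² ≤ 7 · ‖S‖²` for every rank-`≤ 6` tensor `S` in the `2 × 2` format), line
`singlet-fraction-transfer` (lead's reshaped skeleton `Cruxes/SevenEighthsLaw/Lines/singlet_fraction_transfer.lean`).

Slots: `S a b c`, `a = (κ,ν)` the output slot, `b = (κ,μ)`, `c = (μ,ν)`, all in `Fin 2 × Fin 2`.
For an orthonormal `k`-frame `e` of `ℂ^{Fin 2 × Fin 2} ⊗ ℂ^{Fin 2 × Fin 2}` (`⟨f,g⟩ = Σ conj f · g`) write
`τ_{s,a} := Σ_m e_s (a.1,m) (m,a.2)` and `cap e := Σ_s Σ_a |τ_{s,a}|²` (`= Σ_a ‖P_{span e} T_a‖²`, `T_a` the output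
slices of `⟨2,2,2⟩`; `cap ∈ [0, 8]`).

* `sevenEighthsLaw_of_productCapture` — if every orthonormal 6-frame lying in the span of six products
  `u_l ⊗ v_l` has `cap ≤ 7`, then `SevenEighthsLaw` (decompose `S` into six triads, put the six products in an
  honest orthonormal product frame — `stub_productFrame` — and eliminate the output factor exactly —
  `stub_sliceElimination`).
* `productCapture_of_sevenEighthsLaw` — conversely `SevenEighthsLaw` gives `cap e ≤ 7` for every orthonormal
  frame (any size `k`) inside the span of six products: test the law on `S(a,·,·) := P_{span e} T_a`, whose slices
  lie in the span of the six products (so `R(S) ≤ 6`) and for which `⟨S,T⟩ = ‖S‖² = cap e`.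
* `sevenEighthsLaw_iff_productCapture` — the equivalence: the crux IS the statement
  "`c(E) := Σ_a ‖P_E T_a‖² ≤ 7` for every 6-plane `E` spanned by six products" (exact, no loss).
* `sevenEighthsLaw_of_localizedCapture` — the crux from the LOCALIZED CAPTURE LAW (the line's registered
  load-bearing stub `stub_localizedCapture`, k = 6 instance): frames that are column-localizable on the `A` side
  and row-localizable on the `B` side (w.r.t. the standard middle basis) have `cap ≤ 7`; a product-spanned frame
  is such a frame (slicing is linear), so this hypothesis implies the previous one.

Mathlib + the tree (`tensorRank`, `triad`, `matMulTensor`, `exists_eq_sum_triad_of_tensorRank_le`) + the two landed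
stubs. No new definitions.
-/

set_option linter.dupNamespace false

namespace Summit.MatrixMultiplication.MatrixMultiplication.Theorems.SevenEighthsLaw

open scoped BigOperators ComplexConjugate
open Literature.Computability.AlgebraicComplexity
open Summit.MatrixMultiplication.MatrixMultiplication.Theses.FidelityWitnesses

/-- The output slices of a sum of triads `Σ_i w_i ⊗ u_i ⊗ v_i` lie in the span of any family containing the
products `u_i ⊗ v_i`. -/
theorem sum_triad_slice_mem_span {k r : ℕ} (e : Fin k → (Fin 2 × Fin 2) → (Fin 2 × Fin 2) → ℂ)
    (w u v : Fin r → (Fin 2 × Fin 2) → ℂ)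
    (hprod : ∀ l, (fun b c => u l b * v l c) ∈ Submodule.span ℂ (Set.range e)) (a : Fin 2 × Fin 2) :
    (∑ i, triad (w i) (u i) (v i)) a ∈ Submodule.span ℂ (Set.range e) := by
  have hslice : (∑ i, triad (w i) (u i) (v i)) a = ∑ i, w i a • (fun b c => u i b * v i c) := by
    funext b c
    simp [Finset.sum_apply, triad_apply, Pi.smul_apply, smul_eq_mul, mul_assoc]
  rw [hslice]
  exact Submodule.sum_mem _ fun i _ => Submodule.smul_mem _ _ (hprod i)

/-- **The crux from the capture bound.** If every orthonormal 6-frame of `ℂ^{P2} ⊗ ℂ^{P2}` lying in the span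
of six products `u_l ⊗ v_l` has `cap e = Σ_s Σ_a |Σ_m e_s (a.1,m) (m,a.2)|² ≤ 7`, then `SevenEighthsLaw`. -/
theorem sevenEighthsLaw_of_productCapture
    (hcap : ∀ (u v : Fin 6 → (Fin 2 × Fin 2) → ℂ) (e : Fin 6 → (Fin 2 × Fin 2) → (Fin 2 × Fin 2) → ℂ),
      (∀ s t : Fin 6, (∑ b, ∑ c, conj (e s b c) * e t b c) = if s = t then 1 else 0) →
      (∀ s, e s ∈ Submodule.span ℂ (Set.range fun l : Fin 6 => fun b c => u l b * v l c)) →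
      ∑ s, ∑ a : Fin 2 × Fin 2, ‖∑ m : Fin 2, e s (a.1, m) (m, a.2)‖ ^ 2 ≤ 7) :
    SevenEighthsLaw := by
  intro S hS
  obtain ⟨w, u, v, hdec⟩ := exists_eq_sum_triad_of_tensorRank_le hS
  obtain ⟨u', v', e, he, hps, hprod⟩ := stub_productFrame u v
  have hcap' : (∑ s, ∑ a : Fin 2 × Fin 2, ‖∑ m : Fin 2, e s (a.1, m) (m, a.2)‖ ^ 2) ≤ 7 :=
    hcap u' v' e he hps
  have hslices : ∀ a, S a ∈ Submodule.span ℂ (Set.range e) := by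
    intro a
    rw [hdec]
    exact sum_triad_slice_mem_span e w u v hprod a
  have h1 := stub_sliceElimination e he S hslices
  have hnn : (0 : ℝ) ≤ ∑ a, ∑ b, ∑ c, ‖S a b c‖ ^ 2 := by positivity
  calc ‖∑ a, ∑ b, ∑ c, S a b c * matMulTensor ℂ 2 2 2 a b c‖ ^ 2
      ≤ (∑ a, ∑ b, ∑ c, ‖S a b c‖ ^ 2) *
          ∑ s, ∑ a : Fin 2 × Fin 2, ‖∑ m : Fin 2, e s (a.1, m) (m, a.2)‖ ^ 2 := h1
    _ ≤ (∑ a, ∑ b, ∑ c, ‖S a b c‖ ^ 2) * 7 := mul_le_mul_of_nonneg_left hcap' hnn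
    _ = 7 * ∑ a, ∑ b, ∑ c, ‖S a b c‖ ^ 2 := by ring

/-- **The capture bound from the crux.** `SevenEighthsLaw` implies `cap e ≤ 7` for every orthonormal frame `e`
(of any size) inside the span of six products: apply the law to the tensor `S(a,·,·) := Σ_s conj(τ_{s,a}) e_s`
(`= P_{span e} T_a`), which has rank `≤ 6` (its slices are combinations of the six products) and satisfies
`Σ S·T = Σ |S|² = cap e`, so that `cap² ≤ 7·cap`. -/
theorem productCapture_of_sevenEighthsLaw (h : SevenEighthsLaw) {k : ℕ}
    (u v : Fin 6 → (Fin 2 × Fin 2) → ℂ) (e : Fin k → (Fin 2 × Fin 2) → (Fin 2 × Fin 2) → ℂ)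
    (he : ∀ s t : Fin k, (∑ b, ∑ c, conj (e s b c) * e t b c) = if s = t then 1 else 0)
    (hps : ∀ s, e s ∈ Submodule.span ℂ (Set.range fun l : Fin 6 => fun b c => u l b * v l c)) :
    ∑ s, ∑ a : Fin 2 × Fin 2, ‖∑ m : Fin 2, e s (a.1, m) (m, a.2)‖ ^ 2 ≤ 7 := by
  classical
  -- the multiplied vectors and the test tensor
  set τ : Fin k → (Fin 2 × Fin 2) → ℂ := fun s a => ∑ m : Fin 2, e s (a.1, m) (m, a.2) with hτ
  set S : (Fin 2 × Fin 2) → (Fin 2 × Fin 2) → (Fin 2 × Fin 2) → ℂ :=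
    fun a b c => ∑ s, conj (τ s a) * e s b c with hSdef
  -- (i) `R(S) ≤ 6`: every `e_s` is a combination of the six products, hence so is every slice of `S`
  choose d hd using fun s => (Submodule.mem_span_range_iff_exists_fun ℂ).1 (hps s)
  have he_exp : ∀ s b c, e s b c = ∑ l, d s l * (u l b * v l c) := by
    intro s b c
    have := congr_fun (congr_fun (hd s) b) c
    simpa [Finset.sum_apply, Pi.smul_apply, smul_eq_mul] using this.symm
  have hrank : tensorRank S ≤ 6 := by
    refine tensorRank_le_of_eq_sum (fun l a => ∑ s, conj (τ s a) * d s l) u v ?_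
    funext a b c
    simp only [Finset.sum_apply, triad_apply, hSdef]
    calc ∑ s, conj (τ s a) * e s b c
        = ∑ s, ∑ l, conj (τ s a) * d s l * u l b * v l c := by
          refine Finset.sum_congr rfl fun s _ => ?_
          rw [he_exp s b c, Finset.mul_sum]
          exact Finset.sum_congr rfl fun l _ => by ring
      _ = ∑ l, ∑ s, conj (τ s a) * d s l * u l b * v l c := Finset.sum_comm
      _ = ∑ l, (∑ s, conj (τ s a) * d s l) * u l b * v l c := by
          refine Finset.sum_congr rfl fun l _ => ?_
          rw [Finset.sum_mul, Finset.sum_mul]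
  -- (ii) the pairing with `⟨2,2,2⟩` is `Σ_a Σ_s |τ_{s,a}|²`
  have hpair : (∑ a, ∑ b, ∑ c, S a b c * matMulTensor ℂ 2 2 2 a b c) =
      ∑ a, ∑ s, conj (τ s a) * τ s a := by
    refine Finset.sum_congr rfl fun a _ => ?_
    rw [slice_sum_matMulTensor (S a) a]
    simp only [hSdef]
    rw [Finset.sum_comm]
    refine Finset.sum_congr rfl fun s _ => ?_
    rw [← Finset.mul_sum]
  -- (iii) the norm of `S` is the same number (Parseval in the frame, slice by slice)
  have hnorm : (∑ a, ∑ b, ∑ c, ‖S a b c‖ ^ 2) = ∑ a, ∑ s, ‖τ s a‖ ^ 2 := by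
    refine Finset.sum_congr rfl fun a _ => ?_
    have hP := parseval_slice e he (fun s => conj (τ s a)) (S a) (fun b c => by simp [hSdef])
    simpa [Complex.norm_conj] using hP
  -- the real number `C = cap e`
  set C : ℝ := ∑ a, ∑ s, ‖τ s a‖ ^ 2 with hC
  have hC0 : 0 ≤ C := by positivity
  have hpairC : (∑ a, ∑ b, ∑ c, S a b c * matMulTensor ℂ 2 2 2 a b c) = (C : ℂ) := by
    rw [hpair, hC]
    push_cast
    refine Finset.sum_congr rfl fun a _ => Finset.sum_congr rfl fun s _ => ?_
    rw [Complex.conj_mul']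
  -- the law applied to `S`
  have hlaw := h S hrank
  rw [hpairC, hnorm] at hlaw
  have hCC : C ^ 2 ≤ 7 * C := by
    have : ‖(C : ℂ)‖ ^ 2 = C ^ 2 := by
      rw [Complex.norm_real, Real.norm_eq_abs, abs_of_nonneg hC0]
    rw [this] at hlaw
    exact hlaw
  -- conclude `C ≤ 7` and reorder the sum
  have hle : C ≤ 7 := by
    by_contra hlt
    push Not at hlt
    nlinarith [hCC, hlt, hC0, mul_pos (by linarith : (0:ℝ) < C - 7) (by linarith : (0:ℝ) < C)]
  calc ∑ s, ∑ a : Fin 2 × Fin 2, ‖∑ m : Fin 2, e s (a.1, m) (m, a.2)‖ ^ 2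
      = ∑ a : Fin 2 × Fin 2, ∑ s, ‖τ s a‖ ^ 2 := by rw [Finset.sum_comm]
    _ = C := rfl
    _ ≤ 7 := hle

/-- **`SevenEighthsLaw` is EQUIVALENT to the capture bound on product-spanned planes**: `M(2,6) ≤ 7` iff
`c(E) = Σ_a ‖P_E T_a‖² ≤ 7` for (orthonormal 6-frames of) every 6-plane `E` spanned by six products — exact
output elimination loses nothing. -/
theorem sevenEighthsLaw_iff_productCapture :
    SevenEighthsLaw ↔
      ∀ (u v : Fin 6 → (Fin 2 × Fin 2) → ℂ) (e : Fin 6 → (Fin 2 × Fin 2) → (Fin 2 × Fin 2) → ℂ),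
        (∀ s t : Fin 6, (∑ b, ∑ c, conj (e s b c) * e t b c) = if s = t then 1 else 0) →
        (∀ s, e s ∈ Submodule.span ℂ (Set.range fun l : Fin 6 => fun b c => u l b * v l c)) →
        ∑ s, ∑ a : Fin 2 × Fin 2, ‖∑ m : Fin 2, e s (a.1, m) (m, a.2)‖ ^ 2 ≤ 7 :=
  ⟨fun h u v e he hps => productCapture_of_sevenEighthsLaw h u v e he hps,
    sevenEighthsLaw_of_productCapture⟩

/-- **The crux from the LOCALIZED CAPTURE LAW** (the line's load-bearing stub `stub_localizedCapture`, at
`k = 6`). Hypothesis: every orthonormal 6-frame `e` of `ℂ^{P2} ⊗ ℂ^{P2}` whose `μ = j` column-slices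
`(κ, c) ↦ e_s ((κ,j), c)` lie in `span_l {u_l(·,j) ⊗ v_l}` and whose `μ' = j` row-slices `(b, ν) ↦ e_s (b, (j,ν))`
lie in `span_l {u_l ⊗ v_l(j,·)}` (`j = 0, 1`; i.e. `span e ⊆ E_loc = Ê^U ∩ Ê^V`) has `cap e ≤ 7`. A frame inside
`span{u_l ⊗ v_l}` is such a frame (slicing is linear), so `sevenEighthsLaw_of_productCapture` applies. -/
theorem sevenEighthsLaw_of_localizedCapture
    (hloc : ∀ (u v : Fin 6 → (Fin 2 × Fin 2) → ℂ) (e : Fin 6 → (Fin 2 × Fin 2) → (Fin 2 × Fin 2) → ℂ),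
      (∀ s t : Fin 6, (∑ b, ∑ c, conj (e s b c) * e t b c) = if s = t then 1 else 0) →
      (∀ (s : Fin 6) (j : Fin 2), (fun (κ : Fin 2) (c : Fin 2 × Fin 2) => e s (κ, j) c) ∈
        Submodule.span ℂ (Set.range fun l : Fin 6 =>
          fun (κ : Fin 2) (c : Fin 2 × Fin 2) => u l (κ, j) * v l c)) →
      (∀ (s : Fin 6) (j : Fin 2), (fun (b : Fin 2 × Fin 2) (ν : Fin 2) => e s b (j, ν)) ∈
        Submodule.span ℂ (Set.range fun l : Fin 6 =>
          fun (b : Fin 2 × Fin 2) (ν : Fin 2) => u l b * v l (j, ν))) →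
      ∑ s, ∑ a : Fin 2 × Fin 2, ‖∑ m : Fin 2, e s (a.1, m) (m, a.2)‖ ^ 2 ≤ 7) :
    SevenEighthsLaw := by
  refine sevenEighthsLaw_of_productCapture fun u v e he hps => hloc u v e he (fun s j => ?_) (fun s j => ?_)
  · obtain ⟨c, hc⟩ := (Submodule.mem_span_range_iff_exists_fun ℂ).1 (hps s)
    refine (Submodule.mem_span_range_iff_exists_fun ℂ).2 ⟨c, ?_⟩
    funext κ cc
    have := congr_fun (congr_fun hc (κ, j)) cc
    simpa [Finset.sum_apply, Pi.smul_apply, smul_eq_mul] using this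
  · obtain ⟨c, hc⟩ := (Submodule.mem_span_range_iff_exists_fun ℂ).1 (hps s)
    refine (Submodule.mem_span_range_iff_exists_fun ℂ).2 ⟨c, ?_⟩
    funext b ν
    have := congr_fun (congr_fun hc b) (j, ν)
    simpa [Finset.sum_apply, Pi.smul_apply, smul_eq_mul] using this

end Summit.MatrixMultiplication.MatrixMultiplication.Theorems.SevenEighthsLaw
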